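import Literature.Probability.LatticeModels.LatticeGraph
import Literature.Probability.Percolation.Percolation
import Literature.Probability.Percolation.PercolationEvents
import HarnessLib

/-!
# Crossings of a rectangle meeting a line only once, at `p = 1/2` (Zhang 1994, Remark 2 and (2.42))

Topic: Probability / Percolation (bond percolation on the square lattice `ℤ² = Site 2`).

Y. Zhang, *A note on inhomogeneous percolation*, Ann. Probab. **22** (1994) 803–819, proves (Theorem 1)
that at `p = p_c = 1/2` a closed circuit crossing the `X` axis exactly twice exists in the annulus
`[-2n, 2n]² \ [-n, n]²` with probability bounded away from `0` uniformly in `n`, and records as a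
consequence of the proof (Remark 2, p. 805, "the following refined version of the RSW lemma"):

  `P_{p_c}(∃ a left–right open crossing in [-kn, kn] × [-n, n] which only intersects the Y axis once) > C(k)`

for all integers `n > 0`, where `k` is a positive integer and `C(k) > 0` depends only on `k`; the square case
is (2.42) of the proof of Theorem 1 (with top–bottom crossings and the `X` axis, which is the same statement
after the symmetry `(x, y) ↦ (y, x)` of `ℤ²`).  The only input of Zhang's proof beyond the Russo–Seymour–Welsh
theory and the Harris–FKG / van den Berg–Kesten inequalities is a strict form of the BK inequality for two
disjoint closed half-plane arms (his Lemma 1, by the method of Kesten–Zhang, J. Statist. Phys. 46 (1987)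
1031–1056), which yields the half-plane one-arm lower bound `C (k/n)^{1/2-ε}` (his Lemma 4) and makes the
second-moment bound on the number of single-crossing points uniform in `n`.

What is vendored.  `Zhang1994_crossingMeetingAxisOnce` is the Remark-2 statement in the vocabulary of
`Percolation.lean`: a vertex `v = (0, j)`, `|j| ≤ n`, of the `Y` axis, an open path from the left side
`{-kn} × [-n, n]` to `v` all of whose other vertices lie in the left open half `[-kn, -1] × [-n, n]` of the
rectangle, and an open path from `v` to the right side `{kn} × [-n, n]` all of whose other vertices lie in the
right open half `[1, kn] × [-n, n]` (`openConnIn` with the vertex sets `leftHalfRect k n ∪ {v}` and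
`rightHalfRect k n ∪ {v}`).  A left–right open crossing of the rectangle meeting the `Y` axis in exactly one
vertex splits at that vertex into two such paths, so the vendored event CONTAINS Zhang's (his crossings moreover
avoid the bonds joining two boundary vertices, a restriction we do not impose); the vendored inequality is
therefore implied by the printed one.  The weak inequality `C ≤ P(…)` replaces `> C(k)`.

Design choices.
* No new percolation notion is introduced: the rectangle halves are plain `Set (Site 2)`s and the paths are
  `openConnIn` events; the measure is `bondPercolation (zdGraph 2) half` (`half = 1/2 = p_c(ℤ²)`, Kesten).
* The statement is kept at `p = 1/2` and for integer `k ≥ 1`, `n ≥ 1`, exactly as printed.  The closed-bond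
  and top–bottom variants used in Zhang's Theorem 1 / Corollary 1 follow by the complement symmetry of
  `P_{1/2}` and the symmetry `(x, y) ↦ (y, x)`; they are not restated here.
* Use (lane `prim-bschramm`, sharpness seat, memo P5-SHARPNESS §49): with `k = 3` this is the input that turns
  the reinforced-ray theorem `Ray.theta_rayGraph_criticalProb` (Summits, programme RAY) into the reinforced-LINE
  theorem (Zhang's Corollary 1) by Harris' annulus argument; the fact is NOT proved in the tree (it needs the
  Kesten–Zhang strict inequality), so consumers taking it as a hypothesis are conditional results.

Mathlib / tree search: Mathlib has no percolation; the tree has RSW crossings (`Crossings.lean`, `RSWHalf*`),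
half-plane arm events (`HalfPlaneArmAxisInputs.lean`, `Z2HalfPlaneTwoArm.lean`) and the `β₁⁺ ≤ 1/2` bound
(`Summits/…/SharpnessRayArmSquare.lean`), but no single-crossing RSW statement and no strict BK inequality.
-/

noncomputable section

namespace Literature.Probability.Percolation

open MeasureTheory Set LatticeModels

/-- The left open half `[-kn, -1] × [-n, n]` of the rectangle `[-kn, kn] × [-n, n]` (the vertices strictly
left of the `Y` axis). [cite: Zhang1994, Remark 2, p. 805] -/
def leftHalfRect (k n : ℕ) : Set (Site 2) :=
  {v | -((k * n : ℕ) : ℤ) ≤ v 0 ∧ v 0 ≤ -1 ∧ -(n : ℤ) ≤ v 1 ∧ v 1 ≤ n}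

/-- The right open half `[1, kn] × [-n, n]` of the rectangle `[-kn, kn] × [-n, n]` (the vertices strictly
right of the `Y` axis). [cite: Zhang1994, Remark 2, p. 805] -/
def rightHalfRect (k n : ℕ) : Set (Site 2) :=
  {v | 1 ≤ v 0 ∧ v 0 ≤ (k * n : ℕ) ∧ -(n : ℤ) ≤ v 1 ∧ v 1 ≤ n}

/-- **Zhang's single-crossing event**: a left–right open crossing of `[-kn, kn] × [-n, n]` meeting the `Y`
axis only once, written as its two halves — a vertex `v = (0, j)` of the axis (`|j| ≤ n`), an open path from a
vertex `l` of the left side `{-kn} × [-n, n]` to `v` inside `leftHalfRect k n ∪ {v}`, and an open path from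
`v` to a vertex `r` of the right side `{kn} × [-n, n]` inside `rightHalfRect k n ∪ {v}`.
[cite: Zhang1994, Remark 2, p. 805] -/
def crossingMeetingAxisOnce (k n : ℕ) : Set (BondConfig (Site 2)) :=
  {ω | ∃ v l r : Site 2, v 0 = 0 ∧ -(n : ℤ) ≤ v 1 ∧ v 1 ≤ n ∧
    l ∈ leftHalfRect k n ∧ l 0 = -((k * n : ℕ) : ℤ) ∧ r ∈ rightHalfRect k n ∧ r 0 = (k * n : ℕ) ∧
    ω ∈ openConnIn (leftHalfRect k n ∪ {v}) l v ∧ ω ∈ openConnIn (rightHalfRect k n ∪ {v}) v r}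

/-- **Zhang 1994, Remark 2 (the refined RSW lemma; square case = (2.42))**: for bond percolation on `ℤ²` at
`p = p_c = 1/2` and every integer `k ≥ 1` there is `C(k) > 0` such that for all `n ≥ 1`, with probability at
least `C(k)` the rectangle `[-kn, kn] × [-n, n]` has a left–right open crossing meeting the `Y` axis only
once.  Vendored in the (weaker, implied) split form `crossingMeetingAxisOnce`; NOT proved in the tree — Zhang's
proof uses the Kesten–Zhang strict BK inequality (his Lemma 1) through the half-plane one-arm bound
`C (k/n)^{1/2-ε}` (his Lemma 4). [cite: Zhang1994, Remark 2, p. 805; (2.42), p. 818] -/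
def Zhang1994_crossingMeetingAxisOnce : Prop :=
  ∀ k : ℕ, 1 ≤ k → ∃ C : ℝ, 0 < C ∧ ∀ n : ℕ, 1 ≤ n →
    C ≤ (bondPercolation (zdGraph 2) half).real (crossingMeetingAxisOnce k n)

end Literature.Probability.Percolation

end
-- build-touch 2026-08-25T20:01Z T1-D (lead g18): re-land of p403086, declarations byte-identical
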